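/-
Copyright (c) 2026 the pub-hodgecm-mathlib formalisation cell (harness21).  Prover seat hodgecm-mathlib-K2E1-p15 (g2), Track B ∕ K2-LIT, h413 = `stmt-HodgeConjecture-24833`,
line `K2_E1_TraceFormulaBeta`, 5Res ROADCARD AMENDMENT #3 rung G8 (dealer K2E1-plan (g7) (274)(iii)): NO POLE ON THE UNITARY AXIS for a self-dual scattering MATRIX given by
coordinates — the rank-`> 1` twin of ★ p860080 `K2E1ChiUnitaryAxisContinuationCMTwo` §1–§2, in the coordinate currency of ★ p860910 `K2E1SpanOperatorMatrixLetters`.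
-/
import Summits.HodgeConjecture.HodgeConjecture.Theorems.K2E1SpanOperatorMatrixLetters            -- ★ p860910 (K2E4-p10): `exists_family_span_of_coords`, `hFE_of_coords`, `hadj_of_coords`, `hcont_of_coords`
import Summits.HodgeConjecture.HodgeConjecture.Theorems.K2E1PseudoEisensteinPlancherelRadialCMTwo   -- ★ P2 p859946 (K2E1-p13): `eventually_axis_notMem`; brings ★ (136) §0 `eventually_one_sub_notMem_and_conj_notMem`, ★ A `conj_vertical`, normal forms
import HarnessLib

/-!
# G8 — `K2E1ChiScatteringMatrixAxisNoPoleU2`: a SELF-DUAL SCATTERING MATRIX HAS NO POLE ON THE AXIS `Re z = ½`, is UNITARY there at EVERY point, and its coordinates are continuous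
# along the axis — the rank-`> 1` twin of ★ `K2E1ChiUnitaryAxisContinuationCMTwo` §1–§2, GENERIC in the coordinate data `(v, m, P)` of ★ `K2E1SpanOperatorMatrixLetters`

Track B ∕ K2-LIT, crux h413 = `stmt-HodgeConjecture-24833`, route of record `HCCMUnconditional`; cell `hodgecm-mathlib`, squad K2, ENGINE E1; AMENDMENT #3 «GENERAL (U,τ) LADDER» rung G8
(`hcont` at `dim V(χ,K′,ω) > 1`).  THEOREMS ONLY (no `def`, no `instance`, no `notation`, no named-fact hypothesis, no `sorry`; default heartbeats); lane `--supports
stmt-HodgeConjecture-24833 --as helper` (count-neutral).  No automorphic object: linear algebra on `W = span {v_a}` plus one-variable complex analysis on the coordinates.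

THE MATHEMATICS ([MoeglinWaldspurger1995, II.1.8, IV.1.10–IV.1.11, IV.3.12]; [Langlands1976, §7]; [HornJohnson2013, §2.1]).  Let `v : α → E` be a finite linearly independent family in
a complex inner-product space, `W = span {v_a}` (E1: `v_a = [φ_a|_{K_U}]`, `(φ_a)` a basis of `V(χ, K′, ω)`, `χ` self-dual), and let `M(z) ∈ End W` be given by COORDINATES
`M(z) v_a = Σ_c m_z(c,a) v_c` (★ `exists_family_span_of_coords`; `m_z(c,a) = qc_{a,c}(z)`, the scattering coordinates of ★ `chiEisenstein_meromorphic_exports_level_cm_two`).  Assume, off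
a co-discrete set `P` (**hPcd**): the MATRIX FUNCTIONAL EQUATION **(hmFE)** `Σ_c m_{1−z}(d,c)·m_z(c,a) = δ_{da}` (⟹ `M(1−z)M(z) = 1`, ★ `hFE_of_coords`) and the K-PAIRING ADJOINTNESS in
coordinates **(hKA)** `Σ_c m_z(c,a)⟪v_b,v_c⟫ = conj(Σ_c m_{z̄}(c,b)⟪v_a,v_c⟫)` (⟹ `M(z)* = M(z̄)`, ★ `hadj_of_coords`), and that every coordinate is meromorphic in normal form on `ℂ`
(**hmNF**, = export (E2) coordinatewise).  ON THE AXIS `1 − z = z̄`, so `M(z)*M(z) = M(z̄)M(z) = M(1−z)M(z) = 1`: **`M(z)` IS UNITARY ON `W`** at every axis point off `P ∪ (1 − P)` (§1);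
hence `‖M(z)v_a‖ = ‖v_a‖` and, `W` being finite-dimensional, every coordinate `m_z(c,a)` (a continuous linear functional of `M(z)v_a`) is BOUNDED there, uniformly in `z` (§2).  A pole of
`z ↦ m_z(c,a)` at an axis point `z₀` would force `‖m_w(c,a)‖ → ∞` on `𝓝[≠] z₀` (normal form, negative order), in particular along the axis path `z₀ + it`, `t ≠ 0` small, which stays off
`P`, `1 − P` eventually (co-discreteness) — contradiction: **NO COORDINATE HAS A POLE ON THE AXIS** (§3), whatever the bookkeeping set `P` says there.  So every coordinate is continuous
along `t ↦ ½ + it` (§4: EXACTLY the hypothesis `hmc` of ★ `hcont_of_coords`, whence the ★ :184 letter `hcont` with no axis hypothesis on `P`), and by continuity across the exceptional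
`t` (limits along `𝓝[≠] t` are unique, ★ P2's device `eventually_axis_notMem`) the unitarity identities hold at EVERY axis point (§5): `‖M(½+it)u‖ = ‖u‖`, `⟪u, M(½+it)u′⟫ =
⟪M(½−it)u, u′⟫`, `M(½−it)M(½+it) = 1` — the matrix `hs1`∕`hss` of the self-dual Plancherel form.
* §0 `conj_eq_one_sub_of_re_eq_half` (on the axis `z̄ = 1 − z`).
* §1 **`norm_apply_eq_norm_of_re_eq_half`** — `M(z)` is isometric on `W` at axis points off `P ∪ (1 − P)`.
* §2 **`exists_bound_coord_of_re_eq_half`** — `∃ C, ‖m_z(c,a)‖ ≤ C` at those points.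
* §3 **`analyticAt_coord_of_re_eq_half`** — NO POLE ON THE AXIS: `AnalyticAt ℂ (m · c a) z₀` for every `Re z₀ = ½` (the matrix twin of ★ `analyticAt_of_re_eq_half_of_fe_of_conj`).
* §4 **`continuous_coord_axis`** (the `hmc` bytes of ★ `hcont_of_coords`) and **`hcont_of_mfe_of_ka`** (the ★ :184 `hcont` bytes: `t ↦ M(½+it)u` continuous for every `u ∈ W`).
* §5 **`norm_apply_axis_eq_norm`**, **`inner_apply_axis_eq`**, **`apply_reflect_apply_axis`** — unitarity, adjointness `M(½+it)* = M(½−it)` and `M(½−it)M(½+it) = 1` at EVERY `t`.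
HONEST LABEL: HC_CM is proved only modulo the 7 printed citations (2 remaining named inputs: hLiu418 = `stmt-HodgeConjecture-24832`, h413 = `stmt-HodgeConjecture-24833`) until rung 0
closes; this file asserts no named fact and closes no socket; count-neutral; letters `hPcd`, `hmNF`, `hmFE`, `hKA` (all with named payers on ★ p860855's exports: (E3), (E2), the level
matrix FE (G8 FILE 2 of K2E4-p10), the K-pairing adjointness (KA)).

## References
* [MoeglinWaldspurger1995] C. Mœglin, J.-L. Waldspurger, *Spectral decomposition and Eisenstein series* (1995), II.1.8, IV.1.10–IV.1.11, IV.3.12.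
* [Langlands1976] R. P. Langlands, *On the Functional Equations Satisfied by Eisenstein Series*, LNM 544 (1976), §7.
* [HornJohnson2013] R. A. Horn, C. R. Johnson, *Matrix Analysis* (2nd ed., 2013), §2.1.
-/

set_option autoImplicit false
set_option linter.dupNamespace false  -- the mandated namespace repeats the summit's segment (`HodgeConjecture.HodgeConjecture`)

noncomputable section

open Complex Module Filter Topology Set Bornology
open scoped InnerProductSpace ComplexConjugate BigOperators
open Summit.HodgeConjecture.HodgeConjecture.Cruxes.H413.K2E1MellinPaleyWienerHalfLine (conj_vertical)
open Summit.HodgeConjecture.HodgeConjecture.Cruxes.H413.K2E1ScalarUnitaryAxisContinuationCMTwo (eventually_one_sub_notMem_and_conj_notMem)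
open Summit.HodgeConjecture.HodgeConjecture.Cruxes.H413.K2E1PseudoEisensteinPlancherelRadialCMTwo (eventually_axis_notMem)
open Summit.HodgeConjecture.HodgeConjecture.Cruxes.H413.K2E1SpanOperatorMatrixLetters (exists_family_span_of_coords hFE_of_coords hadj_of_coords hcont_of_coords)

namespace Summit.HodgeConjecture.HodgeConjecture.Cruxes.H413.K2E1ChiScatteringMatrixAxisNoPoleU2

variable {E : Type*} [NormedAddCommGroup E] [InnerProductSpace ℂ E] {α : Type*} [Fintype α] [DecidableEq α] {v : α → E} {m : ℂ → α → α → ℂ} {P : Set ℂ}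

/-! ## §0 On the axis `conj z = 1 − z` -/

omit [Fintype α] [DecidableEq α] in
/-- **On the axis `Re z = ½` one has `conj z = 1 − z`.** [folklore] -/
theorem conj_eq_one_sub_of_re_eq_half {z : ℂ} (hz : z.re = 1 / 2) : conj z = 1 - z :=
  Complex.ext (by simp only [Complex.sub_re, Complex.one_re, Complex.conj_re, hz]; norm_num) (by simp only [Complex.sub_im, Complex.one_im, Complex.conj_im, zero_sub])

/-! ## §1 `M(z)` is unitary on `W` at the axis points off `P ∪ (1 − P)` -/

/-- **A SELF-DUAL SCATTERING MATRIX IS ISOMETRIC ON `W` AT EVERY AXIS POINT OFF `P ∪ (1 − P)`**: with `M(z)v_a = Σ_c m_z(c,a)v_c`, the matrix functional equation (hmFE) and the K-pairing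
adjointness (hKA) off `P`, for `Re z = ½`, `z ∉ P`, `1 − z ∉ P`: **`‖M(z)u‖ = ‖u‖`** — `⟪M(z)u, M(z)u⟫ = ⟪M(z̄)M(z)u, u⟫` (★ `hadj_of_coords`) `= ⟪M(1−z)M(z)u, u⟫ = ⟪u, u⟫` (`z̄ = 1 − z`, ★
`hFE_of_coords`). [cite: MoeglinWaldspurger1995, IV.1.10–IV.1.11] [cite: Langlands1976, §7] -/
theorem norm_apply_eq_norm_of_re_eq_half (hv : LinearIndependent ℂ v) {M : ℂ → ↥(Submodule.span ℂ (Set.range v)) →ₗ[ℂ] ↥(Submodule.span ℂ (Set.range v))}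
    (hM : ∀ z a, M z ⟨v a, Submodule.subset_span ⟨a, rfl⟩⟩ = ∑ c, m z c a • (⟨v c, Submodule.subset_span ⟨c, rfl⟩⟩ : ↥(Submodule.span ℂ (Set.range v))))
    (hmFE : ∀ z : ℂ, z ∉ P → 1 - z ∉ P → ∀ d a, ∑ c, m (1 - z) d c * m z c a = if d = a then 1 else 0)
    (hKA : ∀ z : ℂ, z ∉ P → conj z ∉ P → ∀ a b,
      ∑ c, m z c a * ⟪(⟨v b, Submodule.subset_span ⟨b, rfl⟩⟩ : ↥(Submodule.span ℂ (Set.range v))), ⟨v c, Submodule.subset_span ⟨c, rfl⟩⟩⟫_ℂ =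
        conj (∑ c, m (conj z) c b * ⟪(⟨v a, Submodule.subset_span ⟨a, rfl⟩⟩ : ↥(Submodule.span ℂ (Set.range v))), ⟨v c, Submodule.subset_span ⟨c, rfl⟩⟩⟫_ℂ))
    {z : ℂ} (hz : z.re = 1 / 2) (hzP : z ∉ P) (hz'P : 1 - z ∉ P) (u : ↥(Submodule.span ℂ (Set.range v))) : ‖M z u‖ = ‖u‖ := by
  have hcz : conj z = 1 - z := conj_eq_one_sub_of_re_eq_half hz
  have hadj := hadj_of_coords hv hM hKA z hzP (by rw [hcz]; exact hz'P) (M z u) u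
  rw [hcz, hFE_of_coords hv hM hmFE z hzP hz'P u] at hadj
  have h2 : ‖M z u‖ ^ 2 = ‖u‖ ^ 2 := by
    rw [inner_self_eq_norm_sq_to_K, inner_self_eq_norm_sq_to_K] at hadj
    exact_mod_cast hadj
  rw [← Real.sqrt_sq (norm_nonneg (M z u)), h2, Real.sqrt_sq (norm_nonneg u)]

/-! ## §2 The coordinates are bounded at the axis points off `P ∪ (1 − P)` -/

/-- **EVERY COORDINATE `m_z(c,a)` IS BOUNDED AT THE AXIS POINTS OFF `P ∪ (1 − P)`, UNIFORMLY IN `z`**: `m_z(c,a)` is the `c`-th coordinate (w.r.t. the basis `v` of the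
finite-dimensional `W`) of `M(z)v_a`, a continuous linear functional `f_c`, and `‖M(z)v_a‖ = ‖v_a‖` (§1): `‖m_z(c,a)‖ ≤ ‖f_c‖·‖v_a‖`. [cite: MoeglinWaldspurger1995, IV.1.11] [cite: HornJohnson2013, §2.1] -/
theorem exists_bound_coord_of_re_eq_half (hv : LinearIndependent ℂ v)
    (hmFE : ∀ z : ℂ, z ∉ P → 1 - z ∉ P → ∀ d a, ∑ c, m (1 - z) d c * m z c a = if d = a then 1 else 0)
    (hKA : ∀ z : ℂ, z ∉ P → conj z ∉ P → ∀ a b,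
      ∑ c, m z c a * ⟪(⟨v b, Submodule.subset_span ⟨b, rfl⟩⟩ : ↥(Submodule.span ℂ (Set.range v))), ⟨v c, Submodule.subset_span ⟨c, rfl⟩⟩⟫_ℂ =
        conj (∑ c, m (conj z) c b * ⟪(⟨v a, Submodule.subset_span ⟨a, rfl⟩⟩ : ↥(Submodule.span ℂ (Set.range v))), ⟨v c, Submodule.subset_span ⟨c, rfl⟩⟩⟫_ℂ))
    (c a : α) : ∃ C : ℝ, ∀ z : ℂ, z.re = 1 / 2 → z ∉ P → 1 - z ∉ P → ‖m z c a‖ ≤ C := by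
  haveI : FiniteDimensional ℂ ↥(Submodule.span ℂ (Set.range v)) := FiniteDimensional.span_of_finite ℂ (Set.finite_range v)
  obtain ⟨M, hM⟩ := exists_family_span_of_coords hv m
  obtain ⟨f, hf⟩ : ∃ f : ↥(Submodule.span ℂ (Set.range v)) →L[ℂ] ℂ, ∀ x, f x = (Basis.span hv).coord c x :=
    ⟨LinearMap.toContinuousLinearMap ((Basis.span hv).coord c), fun x => congrFun (LinearMap.coe_toContinuousLinearMap' _) x⟩
  have hbw : ∀ i, (Basis.span hv) i = (⟨v i, Submodule.subset_span ⟨i, rfl⟩⟩ : ↥(Submodule.span ℂ (Set.range v))) := fun i => Basis.span_apply hv i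
  have hcoord : ∀ z, f (M z ⟨v a, Submodule.subset_span ⟨a, rfl⟩⟩) = m z c a := fun z => by
    rw [hf, hM z]
    simp_rw [← hbw]
    simp only [Basis.coord_apply, Basis.repr_sum_self]
  refine ⟨‖f‖ * ‖(⟨v a, Submodule.subset_span ⟨a, rfl⟩⟩ : ↥(Submodule.span ℂ (Set.range v)))‖, fun z hz hzP hz'P => ?_⟩
  rw [← hcoord z, ← norm_apply_eq_norm_of_re_eq_half hv hM hmFE hKA hz hzP hz'P]
  exact f.le_opNorm _

/-! ## §3 No pole on the unitary axis -/

/-- **NO COORDINATE OF A SELF-DUAL SCATTERING MATRIX HAS A POLE ON THE AXIS `Re z = ½`** (the matrix twin of ★ `analyticAt_of_re_eq_half_of_fe_of_conj`).  Every `m_·(c,a)` meromorphic in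
normal form on `ℂ` (hmNF), `P` co-discrete (hPcd), (hmFE), (hKA).  Were `z₀` (`Re z₀ = ½`) a pole of `m_·(c,a)`, then `‖m_w(c,a)‖ → ∞` on `𝓝[≠] z₀`; but along the axis path `z₀ + it`,
`t ≠ 0` small — eventually off `P` and `1 − P` — `‖m_w(c,a)‖ ≤ C` (§2).  So `m_·(c,a)` is ANALYTIC at `z₀`, whether or not `z₀ ∈ P`. [cite: MoeglinWaldspurger1995, IV.1.11, IV.3.12] [cite: Langlands1976, §7] -/
theorem analyticAt_coord_of_re_eq_half (hv : LinearIndependent ℂ v) (hPcd : ∀ z₀ : ℂ, ∀ᶠ w in 𝓝[≠] z₀, w ∉ P) (hmNF : ∀ c a, MeromorphicNFOn (fun z => m z c a) univ)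
    (hmFE : ∀ z : ℂ, z ∉ P → 1 - z ∉ P → ∀ d a, ∑ c, m (1 - z) d c * m z c a = if d = a then 1 else 0)
    (hKA : ∀ z : ℂ, z ∉ P → conj z ∉ P → ∀ a b,
      ∑ c, m z c a * ⟪(⟨v b, Submodule.subset_span ⟨b, rfl⟩⟩ : ↥(Submodule.span ℂ (Set.range v))), ⟨v c, Submodule.subset_span ⟨c, rfl⟩⟩⟫_ℂ =
        conj (∑ c, m (conj z) c b * ⟪(⟨v a, Submodule.subset_span ⟨a, rfl⟩⟩ : ↥(Submodule.span ℂ (Set.range v))), ⟨v c, Submodule.subset_span ⟨c, rfl⟩⟩⟫_ℂ))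
    {z₀ : ℂ} (hz₀ : z₀.re = 1 / 2) (c a : α) : AnalyticAt ℂ (fun z => m z c a) z₀ := by
  obtain ⟨C, hC⟩ := exists_bound_coord_of_re_eq_half hv hmFE hKA c a
  have hNF : MeromorphicNFAt (fun z => m z c a) z₀ := hmNF c a (mem_univ z₀)
  by_contra hna
  have hneg : meromorphicOrderAt (fun z => m z c a) z₀ < 0 := lt_of_not_ge fun h => hna (hNF.meromorphicOrderAt_nonneg_iff_analyticAt.1 h)
  have hinf : Tendsto (fun w => ‖m w c a‖) (𝓝[≠] z₀) atTop := tendsto_norm_atTop_iff_cobounded.2 (tendsto_cobounded_of_meromorphicOrderAt_neg hneg)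
  -- eventually on the punctured neighbourhood: large norm, and off `P`, `1 − P`
  have hev : ∀ᶠ w in 𝓝[≠] z₀, C + 1 ≤ ‖m w c a‖ ∧ w ∉ P ∧ (1 - w ∉ P ∧ conj w ∉ P) :=
    (hinf.eventually (eventually_ge_atTop (C + 1))).and ((hPcd z₀).and (eventually_one_sub_notMem_and_conj_notMem hPcd z₀))
  -- push along the axis `t ↦ z₀ + it`
  have hpath : Tendsto (fun t : ℝ => z₀ + (t : ℂ) * I) (𝓝[≠] 0) (𝓝[≠] z₀) := by
    have hc : Continuous fun t : ℝ => z₀ + (t : ℂ) * I := continuous_const.add (continuous_ofReal.mul continuous_const)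
    have h1 : Tendsto (fun t : ℝ => z₀ + (t : ℂ) * I) (𝓝[≠] 0) (𝓝 z₀) := by
      have h := hc.tendsto 0
      simp only [ofReal_zero, zero_mul, add_zero] at h
      exact tendsto_nhdsWithin_of_tendsto_nhds h
    refine tendsto_nhdsWithin_iff.2 ⟨h1, eventually_mem_nhdsWithin.mono fun t ht h => ht ?_⟩
    have h' := congrArg Complex.im h
    simpa using h'
  obtain ⟨t, ⟨hnorm, htP, ht1P, -⟩⟩ := (hpath.eventually hev).exists
  have hre : (z₀ + (t : ℂ) * I).re = 1 / 2 := by simp [hz₀]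
  have hle := hC _ hre htP ht1P
  linarith

/-! ## §4 Continuity along the axis: the `hmc` hypothesis of ★ `hcont_of_coords`, and the ★ :184 letter `hcont` -/

/-- **EVERY COORDINATE IS CONTINUOUS ALONG THE AXIS `t ↦ ½ + it`** (analytic at every axis point, §3) — EXACTLY the hypothesis `hmc` of ★ `K2E1SpanOperatorMatrixLetters.hcont_of_coords`,
with no hypothesis on `P` meeting the axis. [cite: MoeglinWaldspurger1995, IV.1.11, IV.3.12] -/
theorem continuous_coord_axis (hv : LinearIndependent ℂ v) (hPcd : ∀ z₀ : ℂ, ∀ᶠ w in 𝓝[≠] z₀, w ∉ P) (hmNF : ∀ c a, MeromorphicNFOn (fun z => m z c a) univ)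
    (hmFE : ∀ z : ℂ, z ∉ P → 1 - z ∉ P → ∀ d a, ∑ c, m (1 - z) d c * m z c a = if d = a then 1 else 0)
    (hKA : ∀ z : ℂ, z ∉ P → conj z ∉ P → ∀ a b,
      ∑ c, m z c a * ⟪(⟨v b, Submodule.subset_span ⟨b, rfl⟩⟩ : ↥(Submodule.span ℂ (Set.range v))), ⟨v c, Submodule.subset_span ⟨c, rfl⟩⟩⟫_ℂ =
        conj (∑ c, m (conj z) c b * ⟪(⟨v a, Submodule.subset_span ⟨a, rfl⟩⟩ : ↥(Submodule.span ℂ (Set.range v))), ⟨v c, Submodule.subset_span ⟨c, rfl⟩⟩⟫_ℂ))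
    (c a : α) : Continuous fun t : ℝ => m ((((1 / 2 : ℝ)) : ℂ) + t * I) c a := by
  have hg : Continuous fun s : ℝ => (((1 / 2 : ℝ)) : ℂ) + s * I := continuous_const.add (continuous_ofReal.mul continuous_const)
  refine continuous_iff_continuousAt.2 fun t => ?_
  have ha := (analyticAt_coord_of_re_eq_half hv hPcd hmNF hmFE hKA (z₀ := (((1 / 2 : ℝ)) : ℂ) + t * I) (by simp) c a).continuousAt
  change ContinuousAt ((fun z => m z c a) ∘ fun s : ℝ => (((1 / 2 : ℝ)) : ℂ) + s * I) t
  exact ha.comp_of_eq hg.continuousAt rfl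

/-- **THE ★ :184 LETTER `hcont` FOR A SELF-DUAL SCATTERING MATRIX**: `t ↦ M(½ + it)u` is continuous for every `u ∈ W` (★ `hcont_of_coords` fed with §4 `continuous_coord_axis`) — from
(hPcd), (hmNF), (hmFE), (hKA) alone. [cite: MoeglinWaldspurger1995, IV.1.11, IV.3.12] -/
theorem hcont_of_mfe_of_ka (hv : LinearIndependent ℂ v) {M : ℂ → ↥(Submodule.span ℂ (Set.range v)) →ₗ[ℂ] ↥(Submodule.span ℂ (Set.range v))}
    (hM : ∀ z a, M z ⟨v a, Submodule.subset_span ⟨a, rfl⟩⟩ = ∑ c, m z c a • (⟨v c, Submodule.subset_span ⟨c, rfl⟩⟩ : ↥(Submodule.span ℂ (Set.range v))))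
    (hPcd : ∀ z₀ : ℂ, ∀ᶠ w in 𝓝[≠] z₀, w ∉ P) (hmNF : ∀ c a, MeromorphicNFOn (fun z => m z c a) univ)
    (hmFE : ∀ z : ℂ, z ∉ P → 1 - z ∉ P → ∀ d a, ∑ c, m (1 - z) d c * m z c a = if d = a then 1 else 0)
    (hKA : ∀ z : ℂ, z ∉ P → conj z ∉ P → ∀ a b,
      ∑ c, m z c a * ⟪(⟨v b, Submodule.subset_span ⟨b, rfl⟩⟩ : ↥(Submodule.span ℂ (Set.range v))), ⟨v c, Submodule.subset_span ⟨c, rfl⟩⟩⟫_ℂ =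
        conj (∑ c, m (conj z) c b * ⟪(⟨v a, Submodule.subset_span ⟨a, rfl⟩⟩ : ↥(Submodule.span ℂ (Set.range v))), ⟨v c, Submodule.subset_span ⟨c, rfl⟩⟩⟫_ℂ)) :
    ∀ u : ↥(Submodule.span ℂ (Set.range v)), Continuous fun t : ℝ => M ((((1 / 2 : ℝ)) : ℂ) + t * I) u :=
  hcont_of_coords hv hM fun c a => continuous_coord_axis hv hPcd hmNF hmFE hKA c a

/-! ## §5 At EVERY axis point: unitarity, adjointness `M(½+it)* = M(½−it)`, and `M(½−it)M(½+it) = 1` -/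

/-- **`‖M(½ + it)u‖ = ‖u‖` FOR EVERY REAL `t` AND EVERY `u ∈ W`** — `M(½+it)` is UNITARY on `W` at every axis point: generically along the axis (off `P`, `1 − P`, eventually on `𝓝[≠] t`,
★ `eventually_axis_notMem`) by §1, and across the exceptional `t` by continuity (§4; limits along `𝓝[≠] t` are unique). [cite: MoeglinWaldspurger1995, IV.3.12] [cite: Langlands1976, §7] -/
theorem norm_apply_axis_eq_norm (hv : LinearIndependent ℂ v) {M : ℂ → ↥(Submodule.span ℂ (Set.range v)) →ₗ[ℂ] ↥(Submodule.span ℂ (Set.range v))}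
    (hM : ∀ z a, M z ⟨v a, Submodule.subset_span ⟨a, rfl⟩⟩ = ∑ c, m z c a • (⟨v c, Submodule.subset_span ⟨c, rfl⟩⟩ : ↥(Submodule.span ℂ (Set.range v))))
    (hPcd : ∀ z₀ : ℂ, ∀ᶠ w in 𝓝[≠] z₀, w ∉ P) (hmNF : ∀ c a, MeromorphicNFOn (fun z => m z c a) univ)
    (hmFE : ∀ z : ℂ, z ∉ P → 1 - z ∉ P → ∀ d a, ∑ c, m (1 - z) d c * m z c a = if d = a then 1 else 0)
    (hKA : ∀ z : ℂ, z ∉ P → conj z ∉ P → ∀ a b,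
      ∑ c, m z c a * ⟪(⟨v b, Submodule.subset_span ⟨b, rfl⟩⟩ : ↥(Submodule.span ℂ (Set.range v))), ⟨v c, Submodule.subset_span ⟨c, rfl⟩⟩⟫_ℂ =
        conj (∑ c, m (conj z) c b * ⟪(⟨v a, Submodule.subset_span ⟨a, rfl⟩⟩ : ↥(Submodule.span ℂ (Set.range v))), ⟨v c, Submodule.subset_span ⟨c, rfl⟩⟩⟫_ℂ))
    (t : ℝ) (u : ↥(Submodule.span ℂ (Set.range v))) : ‖M ((((1 / 2 : ℝ)) : ℂ) + t * I) u‖ = ‖u‖ := by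
  have hcont : ContinuousAt (fun s : ℝ => ‖M ((((1 / 2 : ℝ)) : ℂ) + s * I) u‖) t := ((hcont_of_mfe_of_ka hv hM hPcd hmNF hmFE hKA u).continuousAt).norm
  have hev : ∀ᶠ s : ℝ in 𝓝[≠] t, ‖M ((((1 / 2 : ℝ)) : ℂ) + (s : ℂ) * I) u‖ = ‖u‖ := by
    filter_upwards [eventually_axis_notMem hPcd t] with s hs
    exact norm_apply_eq_norm_of_re_eq_half hv hM hmFE hKA (by simp) hs.1 hs.2.1 u
  exact tendsto_nhds_unique (hcont.tendsto.mono_left nhdsWithin_le_nhds) (tendsto_const_nhds.congr' (hev.mono fun s hs => hs.symm))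

/-- **`⟪u, M(½ + it)u′⟫ = ⟪M(½ − it)u, u′⟫` FOR EVERY REAL `t`** — on the axis the adjoint of `M(½+it)` is `M(½−it)`: generically (hKA) via ★ `hadj_of_coords` with `conj(½ + it) = ½ − it`
(★ `conj_vertical`); across the exceptional `t` by continuity of both sides (§4). [cite: MoeglinWaldspurger1995, II.1.8, IV.1.11] [cite: Langlands1976, §7] -/
theorem inner_apply_axis_eq (hv : LinearIndependent ℂ v) {M : ℂ → ↥(Submodule.span ℂ (Set.range v)) →ₗ[ℂ] ↥(Submodule.span ℂ (Set.range v))}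
    (hM : ∀ z a, M z ⟨v a, Submodule.subset_span ⟨a, rfl⟩⟩ = ∑ c, m z c a • (⟨v c, Submodule.subset_span ⟨c, rfl⟩⟩ : ↥(Submodule.span ℂ (Set.range v))))
    (hPcd : ∀ z₀ : ℂ, ∀ᶠ w in 𝓝[≠] z₀, w ∉ P) (hmNF : ∀ c a, MeromorphicNFOn (fun z => m z c a) univ)
    (hmFE : ∀ z : ℂ, z ∉ P → 1 - z ∉ P → ∀ d a, ∑ c, m (1 - z) d c * m z c a = if d = a then 1 else 0)
    (hKA : ∀ z : ℂ, z ∉ P → conj z ∉ P → ∀ a b,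
      ∑ c, m z c a * ⟪(⟨v b, Submodule.subset_span ⟨b, rfl⟩⟩ : ↥(Submodule.span ℂ (Set.range v))), ⟨v c, Submodule.subset_span ⟨c, rfl⟩⟩⟫_ℂ =
        conj (∑ c, m (conj z) c b * ⟪(⟨v a, Submodule.subset_span ⟨a, rfl⟩⟩ : ↥(Submodule.span ℂ (Set.range v))), ⟨v c, Submodule.subset_span ⟨c, rfl⟩⟩⟫_ℂ))
    (t : ℝ) (u u' : ↥(Submodule.span ℂ (Set.range v))) :
    ⟪u, M ((((1 / 2 : ℝ)) : ℂ) + t * I) u'⟫_ℂ = ⟪M ((((1 / 2 : ℝ)) : ℂ) + ((-t : ℝ) : ℂ) * I) u, u'⟫_ℂ := by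
  have h1 : ContinuousAt (fun s : ℝ => ⟪u, M ((((1 / 2 : ℝ)) : ℂ) + s * I) u'⟫_ℂ) t := (continuous_const.inner (hcont_of_mfe_of_ka hv hM hPcd hmNF hmFE hKA u')).continuousAt
  have h2 : ContinuousAt (fun s : ℝ => ⟪M ((((1 / 2 : ℝ)) : ℂ) + ((-s : ℝ) : ℂ) * I) u, u'⟫_ℂ) t :=
    (((hcont_of_mfe_of_ka hv hM hPcd hmNF hmFE hKA u).comp continuous_neg).inner continuous_const).continuousAt
  have hev : ∀ᶠ s : ℝ in 𝓝[≠] t, ⟪u, M ((((1 / 2 : ℝ)) : ℂ) + (s : ℂ) * I) u'⟫_ℂ = ⟪M ((((1 / 2 : ℝ)) : ℂ) + ((-s : ℝ) : ℂ) * I) u, u'⟫_ℂ := by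
    filter_upwards [eventually_axis_notMem hPcd t] with s hs
    rw [← conj_vertical]
    exact hadj_of_coords hv hM hKA _ hs.1 hs.2.2 u u'
  exact tendsto_nhds_unique (h1.tendsto.mono_left nhdsWithin_le_nhds) ((h2.tendsto.mono_left nhdsWithin_le_nhds).congr' (hev.mono fun s hs => hs.symm))

/-- **`M(½ − it)(M(½ + it)u) = u` FOR EVERY REAL `t`** — the functional equation across the axis at every point: `M(½+it)` is an isometry of `W` (§5 `norm_apply_axis_eq_norm`), so
`⟪M(½−it)M(½+it)u, u′⟫ = ⟪M(½+it)u, M(½+it)u′⟫ = ⟪u, u′⟫` (adjointness §5 `inner_apply_axis_eq`, `LinearIsometry.inner_map_map`) for all `u′`. [cite: MoeglinWaldspurger1995, IV.1.10, IV.3.12] [cite: Langlands1976, §7] -/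
theorem apply_reflect_apply_axis (hv : LinearIndependent ℂ v) {M : ℂ → ↥(Submodule.span ℂ (Set.range v)) →ₗ[ℂ] ↥(Submodule.span ℂ (Set.range v))}
    (hM : ∀ z a, M z ⟨v a, Submodule.subset_span ⟨a, rfl⟩⟩ = ∑ c, m z c a • (⟨v c, Submodule.subset_span ⟨c, rfl⟩⟩ : ↥(Submodule.span ℂ (Set.range v))))
    (hPcd : ∀ z₀ : ℂ, ∀ᶠ w in 𝓝[≠] z₀, w ∉ P) (hmNF : ∀ c a, MeromorphicNFOn (fun z => m z c a) univ)
    (hmFE : ∀ z : ℂ, z ∉ P → 1 - z ∉ P → ∀ d a, ∑ c, m (1 - z) d c * m z c a = if d = a then 1 else 0)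
    (hKA : ∀ z : ℂ, z ∉ P → conj z ∉ P → ∀ a b,
      ∑ c, m z c a * ⟪(⟨v b, Submodule.subset_span ⟨b, rfl⟩⟩ : ↥(Submodule.span ℂ (Set.range v))), ⟨v c, Submodule.subset_span ⟨c, rfl⟩⟩⟫_ℂ =
        conj (∑ c, m (conj z) c b * ⟪(⟨v a, Submodule.subset_span ⟨a, rfl⟩⟩ : ↥(Submodule.span ℂ (Set.range v))), ⟨v c, Submodule.subset_span ⟨c, rfl⟩⟩⟫_ℂ))
    (t : ℝ) (u : ↥(Submodule.span ℂ (Set.range v))) :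
    M ((((1 / 2 : ℝ)) : ℂ) + ((-t : ℝ) : ℂ) * I) (M ((((1 / 2 : ℝ)) : ℂ) + t * I) u) = u := by
  -- `M(½ + it)` as a linear isometry of `W`
  let T : ↥(Submodule.span ℂ (Set.range v)) →ₗᵢ[ℂ] ↥(Submodule.span ℂ (Set.range v)) :=
    { toLinearMap := M ((((1 / 2 : ℝ)) : ℂ) + t * I), norm_map' := fun w => norm_apply_axis_eq_norm hv hM hPcd hmNF hmFE hKA t w }
  refine ext_inner_right ℂ fun u' => ?_
  rw [← inner_apply_axis_eq hv hM hPcd hmNF hmFE hKA t (M ((((1 / 2 : ℝ)) : ℂ) + t * I) u) u']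
  exact T.inner_map_map u u'

end Summit.HodgeConjecture.HodgeConjecture.Cruxes.H413.K2E1ChiScatteringMatrixAxisNoPoleU2

end
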